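import Summits.NavierStokesRegularity.NavierStokesRegularity.Theorems.SoloRefuteWashburn2026Tilted

/-!
# C159 `Washburn2026` — tilted Burgers layers (III): kernel refutation of Lemma 3.5's universal
# vorticity-gradient bound (p.5 l.60–62, skeleton rev. 2 `Lemma35_SerrinGrad`)

For the tilted layer `W7 κ ∈ IsAE 1` of part I, `∇ω(x) h = h₀ V_κ''(x₀) e₃` and
`|∇ω(1/(2κ), 0, 0)| = κ V_κ'(1/(2κ)) ≥ 3κ/5 → ∞`: no constant `C_Ser` bounds `‖∇ω‖_∞` on the typed
class (the class fixes `sup|ω| = 1` but not the solution's own length scale).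
WHAT THIS IS NOT: not a claim about NS regularity or blow-up; not a claim about any author beyond the
typed locator.
-/

set_option linter.dupNamespace false
noncomputable section
open Real Set Function InnerProductSpace MeasureTheory
open scoped RealInnerProductSpace ContDiff Topology ENNReal Laplacian

namespace Summit.NavierStokesRegularity.NavierStokesRegularity.Theorems.Washburn2026Tilted
open Literature.Analysis.FluidPDE Literature.Analysis.FluidPDE.StrainedShear
open Literature.Claims.NS.Washburn2026 (E3 rho xi gradXi Eomega IsAE Cor53_Coherence Prop72_BelowStruwe
  Theorem74_GradBound Step1_75_Transfer Theorem75_DirectionConstancy)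

/-! ## Lemma 3.5's universal vorticity-gradient bound -/

/-- The vorticity gradient of `W7 κ`: `∇ω(x) h = h₀ g'(x₀) e₃`. [folklore] -/
theorem hasFDerivAt_curl {κ : ℝ} (hκ : 0 < κ) (t : ℝ) (x : E3) :
    HasFDerivAt (curl (W7 κ t)) ((ContinuousLinearMap.smulRight (1 : ℝ →L[ℝ] ℝ) (vort' κ (x 0))).comp
      (EuclideanSpace.proj (0 : Fin 3))) x := by
  rw [show curl (W7 κ t) = fun y => vort κ (y 0) from funext (curl_W7 hκ t)]
  exact (hasDerivAt_vort κ (x 0)).hasFDerivAt.comp x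
    (EuclideanSpace.proj (0 : Fin 3) : E3 →L[ℝ] ℝ).hasFDerivAt

/-- `|∇ω(pt κ)| ≥ 3κ/5` for `W7 κ`. [folklore] -/
theorem fderiv_curl_ge_pt {κ : ℝ} (hκ : 0 < κ) (t : ℝ) : 3 * κ / 5 ≤ ‖fderiv ℝ (curl (W7 κ t)) (pt κ)‖ := by
  -- `‖e₃‖ = 1`, kept local (a top-level restatement collides with an unrelated tree lemma by name+face)
  have norm_e3 : ‖e3‖ = 1 := by simp [e3]
  have h0 : pt κ 0 = 1 / (2 * κ) := by simp [pt]
  have hg : 3 / 5 ≤ g κ (1 / (2 * κ)) := g_ge hκ (by positivity) le_rfl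
  have hg' : |g' κ (1 / (2 * κ))| = κ * g κ (1 / (2 * κ)) := by
    rw [g', show -(2 * κ ^ 2 * (1 / (2 * κ))) * g κ (1 / (2 * κ)) = -(κ * g κ (1 / (2 * κ))) by
      field_simp, abs_neg, abs_of_nonneg (by positivity)]
  rw [(hasFDerivAt_curl hκ t (pt κ)).fderiv, h0]
  calc 3 * κ / 5 ≤ κ * g κ (1 / (2 * κ)) := by nlinarith
    _ = ‖vort' κ (1 / (2 * κ))‖ := by rw [vort', norm_smul, norm_e3, mul_one, Real.norm_eq_abs, hg']
    _ = ‖((ContinuousLinearMap.smulRight (1 : ℝ →L[ℝ] ℝ) (vort' κ (1 / (2 * κ)))).comp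
          (EuclideanSpace.proj (0 : Fin 3))) (EuclideanSpace.single 0 1 : E3)‖ := by simp
    _ ≤ _ := ContinuousLinearMap.le_opNorm _ _
    _ = _ := by simp

/-- **Refutes Lemma 3.5 p.5 l.60–62, quantitative form** («‖∇ω‖_{L∞(Q_{1/2})} ≤ C_Ser», universal for the
class): `|∇ω(pt κ)| ≥ 3κ/5 → ∞` on `W7 κ ∈ IsAE 1`. [cite: Washburn2026, Lemma 3.5 p.5 l.60–62] -/
theorem not_Lemma35_SerrinGrad : ¬ Literature.Claims.NS.Washburn2026.Lemma35_SerrinGrad := by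
  intro h
  obtain ⟨C, hC⟩ := h 1 one_pos
  set κ : ℝ := 5 / 3 * |C| + 1 with hκ
  have hκ0 : 0 < κ := by positivity
  have h1 := hC (W7 κ) (P7 κ) (isAE_W7 hκ0) 0 le_rfl (pt κ)
  have h2 := fderiv_curl_ge_pt hκ0 0
  have h4 := le_abs_self C
  linarith

end Summit.NavierStokesRegularity.NavierStokesRegularity.Theorems.Washburn2026Tilted
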